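import Mathlib
import Summits.ValiantsHypothesis.ValiantsHypothesis.Theses.RigidMinimalReps
import Summits.ValiantsHypothesis.ValiantsHypothesis.Theorems.BorderApolarityToricWitnessObstructionQPStubTorusBound

/-!
# `RigidMinimalReps.TorusBound` (crux stmt-ValiantsHypothesis-5114, route RigidMinimalReps, rank 3)

**Statement.** For `n ≥ 3`, every affine determinantal representation `Ã = Λ + Σ x_{kj} A_{kj}` of
`per_n` over `ℂ` (size `m`) which is equivariant with exact lifts (`IsEquivariantDetRepr`) for the
two-sided torus `x_{kj} ↦ d_k e_j x_{kj}` (`d_k, e_j ≠ 0`) has `2 ^ n - 1 ≤ m`.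

**Proof.** The sibling crux `RigidityForcesSymmetry.TorusBound` (stmt-ValiantsHypothesis-4164) is the
same statement for the subgroup generated by ALL invertible `diag(d_k e_j)` (without recording
`d_k ≠ 0`, `e_j ≠ 0`), and is a tree theorem
(`Theorems.BorderApolarityToricWitnessObstructionQP.stub_torusBound`: von zur Gathen regularity, one
generic torus element `diag(p) ⊗ diag(q)` over `2n` distinct primes, its exact lift, the pencil on the
graph of each `σ ∈ 𝔖_n`, and the graded pigeonhole `Σ_{s=1}^n C(n,s) = 2^n - 1`).  Invertibility of
`diag(d_k e_j)` forces every `d_k ≠ 0` and `e_j ≠ 0` (read the diagonal entries `(k,k)` and `(j,j)`), so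
the stmt-4164 generator set is contained in the stmt-5114 one, the generated subgroups are nested
(`closure_twoSidedGens_le`; they are in fact equal), and equivariance for the larger subgroup restricts
to the smaller (`IsEquivariantDetRepr.anti`).  This is exactly §4 of the registered line
`Cruxes/TorusBound/Lines/birth.lean`, with the two registered stubs discharged wholesale by the tree
theorem.
-/

open Literature.Computability.AlgebraicComplexity

-- the mandated summit-side namespace repeats a component by design (single-conjunct summit)
set_option linter.dupNamespace false

namespace Summit.ValiantsHypothesis.ValiantsHypothesis.Theorems.RigidMinimalRepsTorusBound

/-- The stmt-4164 generator set (all invertible `diag(d_k e_j)`) is contained in the stmt-5114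
generator set (the same with `d_k ≠ 0`, `e_j ≠ 0` recorded): the determinant `∏ d_k e_j` of an
invertible diagonal matrix is non-zero, so every `d_k e_k ≠ 0` and every `d_j e_j ≠ 0`. [folklore] -/
theorem twoSidedGens_subset (n : ℕ) :
    {γ : GL (Fin n × Fin n) ℂ | ∃ d e : Fin n → ℂ,
        (γ : Matrix (Fin n × Fin n) (Fin n × Fin n) ℂ) = Matrix.diagonal (fun p => d p.1 * e p.2)} ⊆
    {γ : Matrix.GeneralLinearGroup (Fin n × Fin n) ℂ | ∃ d e : Fin n → ℂ, (∀ i, d i ≠ 0) ∧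
        (∀ j, e j ≠ 0) ∧
        (γ : Matrix (Fin n × Fin n) (Fin n × Fin n) ℂ) = Matrix.diagonal (fun p => d p.1 * e p.2)} := by
  rintro γ ⟨d, e, hγ⟩
  have hdet : (γ : Matrix (Fin n × Fin n) (Fin n × Fin n) ℂ).det ≠ 0 := by
    rw [← Matrix.GeneralLinearGroup.val_det_apply]
    exact Units.ne_zero _
  rw [hγ, Matrix.det_diagonal] at hdet
  have hne : ∀ i j : Fin n, d i * e j ≠ 0 := fun i j =>
    Finset.prod_ne_zero_iff.1 hdet (i, j) (Finset.mem_univ _)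
  exact ⟨d, e, fun i => left_ne_zero_of_mul (hne i i), fun j => right_ne_zero_of_mul (hne j j), hγ⟩

/-- The two two-sided-torus subgroups are nested: the subgroup generated by all invertible
`diag(d_k e_j)` (stmt-4164) lies below the one generated by those with `d_k, e_j ≠ 0` recorded
(stmt-5114).  (They coincide; only this inclusion is needed.) [folklore] -/
theorem closure_twoSidedGens_le (n : ℕ) :
    Subgroup.closure {γ : GL (Fin n × Fin n) ℂ | ∃ d e : Fin n → ℂ,
        (γ : Matrix (Fin n × Fin n) (Fin n × Fin n) ℂ) = Matrix.diagonal (fun p => d p.1 * e p.2)} ≤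
    Subgroup.closure {γ : Matrix.GeneralLinearGroup (Fin n × Fin n) ℂ | ∃ d e : Fin n → ℂ,
        (∀ i, d i ≠ 0) ∧ (∀ j, e j ≠ 0) ∧
        (γ : Matrix (Fin n × Fin n) (Fin n × Fin n) ℂ) = Matrix.diagonal (fun p => d p.1 * e p.2)} :=
  Subgroup.closure_mono (twoSidedGens_subset n)

/-- **`RigidMinimalReps.TorusBound` (crux stmt-ValiantsHypothesis-5114).**  For `n ≥ 3`, an affine
determinantal representation of `per_n` over `ℂ` with exact lifts of the two-sided torus
`x_{kj} ↦ d_k e_j x_{kj}` (`d_k, e_j ≠ 0`) has size `m ≥ 2 ^ n - 1`.  Equivariance for the stmt-5114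
torus restricts (`IsEquivariantDetRepr.anti`, `closure_twoSidedGens_le`) to equivariance for the
stmt-4164 torus, and the tree theorem `BorderApolarityToricWitnessObstructionQP.stub_torusBound`
(= `RigidityForcesSymmetry.TorusBound`: regularity, one generic prime torus element and its exact lift,
pencils on permutation graphs, graded pigeonhole) gives the bound.  Tight by Grenet's representation.
[cite: LandsbergRessayre2017, Thm. 2.8, §6] [cite: Vonzurgathen1987, Thm. 3.1] [cite: Grenet2011] -/
theorem torusBound_proof :
    Summit.ValiantsHypothesis.ValiantsHypothesis.Theses.RigidMinimalReps.TorusBound := by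
  unfold Summit.ValiantsHypothesis.ValiantsHypothesis.Theses.RigidMinimalReps.TorusBound
  intro n hn m A hA
  exact BorderApolarityToricWitnessObstructionQP.stub_torusBound n hn m A
    (hA.anti (closure_twoSidedGens_le n))

end Summit.ValiantsHypothesis.ValiantsHypothesis.Theorems.RigidMinimalRepsTorusBound
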